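import Summits.RiemannHypothesis.RiemannHypothesis.Theses.SignCone
import Summits.RiemannHypothesis.RiemannHypothesis.Theorems.SignConeConeMagnificationStubCombZeroSide
import Literature.NumberTheory.LFunctions.WeilExplicit
import Literature.NumberTheory.LFunctions.WeilExplicitFormulaProofs
import Literature.NumberTheory.LFunctions.WeilCombZeroSideComplex
import Literature.NumberTheory.LFunctions.WeilCombNormLowerBoundComplex
import Literature.NumberTheory.LFunctions.WeilSmallSupportPositivity
import HarnessLib

/-!
# Stub `stub_combZeroSideC` of line `Sketch` for crux `SignCone.ConeMagnification`
(item stmt-RiemannHypothesis-16303, route route-RiemannHypothesis-SignCone)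

**`ζ`-MOLLIFIED COMBS OF A COMPLEX RESONATOR ARE WEIL-NEUTRAL** — the complex-coefficient
version of `stub_combZeroSide`
(`Summits/RiemannHypothesis/RiemannHypothesis/Theorems/SignConeConeMagnificationStubCombZeroSide.lean`),
needed for the Riesz–Euler designs of the core rotated by phases `e^{i|A|φ}`.
For a finitely supported complex resonator `α : ℕ → ℂ` (support `≤ L`), a Weil test `b₁`
supported in `[-1, 1]`, `0 < θ < 1`, `κ = (log M)^θ` and the comb
`g(u) = ∑_{m ≤ LM} a_m b₁((u - log m) M/κ)`, `a_m = ∑_{k ∣ m, k ≤ M} α(m/k)/√k`, the full Weil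
functional of `K = g ⋆ g̃` is `o(‖g‖₂²)`:
`|Re (W_polar(K) + W_arch(K) - P_Λ(K))| ≤ ε ‖g‖₂²` for all `M ≥ M₀(α, L, b₁, θ, ε)`.

Proof.  Verbatim the real-resonator proof, since the zero sum is bounded ABSOLUTELY.  By the
explicit formula (`explicit_formula_holds`) `W(K)` is the limit of the truncated zero sides, each
bounded by `C C_α² (κ/M)² (‖b₁‖'² M + ‖b₁^{(n)}‖'² κ^{-2n} (1 + log M)³ M)`, `C_α = ∑ ‖α_ℓ‖ √ℓ`
(`Literature.NumberTheory.LFunctions.exists_norm_weilZeroSidePartial_comb_le_complex`: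
`K̂(ρ) = ĝ(ρ) conj ĝ(1-ρ̄)`, `ĝ = (κ/M) b̂₁ Ã ζ_M(1-s)`, `|Ã| ≤ C_α`); on the other side
`‖g‖₂² ≥ (κ/M) ‖b₁‖₂² (c log(M/κ) - C)`
(`Literature.NumberTheory.LFunctions.exists_integral_norm_sq_comb_ge_complex`: disjoint teeth and
`∑ ‖a_m‖² ≫ log` via `Re α` or `Im α`).  With `κ = (log M)^θ` and `θ(2n-1) > 2` the ratio tends
to `0` (`eventually_budget_nat` of the real file).  The degenerate cases (`α ≡ 0` on `[1, L]` or
`b₁ ≡ 0`) give `g ≡ 0` and `0 ≤ 0`.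
-/

noncomputable section

-- `Summit.RiemannHypothesis.RiemannHypothesis.…` repeats a namespace component by design (D-0017 layout).
set_option linter.dupNamespace false

open scoped BigOperators ComplexConjugate Topology
open Complex MeasureTheory Set Filter

namespace Summit.RiemannHypothesis.RiemannHypothesis.Theorems.SignConeConeMagnification

open Literature.NumberTheory.LFunctions

/-! ## The stub -/

/-- **Stub `stub_combZeroSideC` (registered signature): `ζ`-mollified combs of a complex
resonator are Weil-neutral.**  For a finitely supported complex resonator `α : ℕ → ℂ`
(`α_m = 0` for `m > L`), a Weil test `b₁` supported in `[-1, 1]`, `0 < θ < 1` and `ε > 0` there is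
`M₀` such that for all `M ≥ M₀`, with `κ = (log M)^θ` and
`g(u) = ∑_{m ≤ LM} (∑_{k ∣ m, k ≤ M} α(m/k)/√k) b₁((u - log m) M/κ)`,
`|Re (W_polar(g ⋆ g̃) + W_arch(g ⋆ g̃) - ∑ₙ Λ(n) n^{-1/2} ((g ⋆ g̃)(log n) + (g ⋆ g̃)(-log n)))|`
`≤ ε ∫ ‖g‖²`. [folklore] -/
theorem stub_combZeroSideC :
    ∀ α : ℕ → ℂ, ∀ L : ℕ, (∀ m, L < m → α m = 0) →
      ∀ b₁ : ℝ → ℂ, IsWeilTest b₁ → tsupport b₁ ⊆ Set.Icc (-1) 1 →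
      ∀ θ : ℝ, 0 < θ → θ < 1 → ∀ ε : ℝ, 0 < ε → ∃ M₀ : ℕ, ∀ M : ℕ, M₀ ≤ M →
        let κ : ℝ := Real.log M ^ θ
        let g : ℝ → ℂ := fun u => ∑ m ∈ Finset.range (L * M + 1),
          (∑ k ∈ (Nat.divisors m).filter (· ≤ M), α (m / k) / (Real.sqrt k : ℂ)) *
            b₁ ((u - Real.log m) * (M : ℝ) / κ)
        |(weilPolarTerm (weilConv g (weilReflect g)) + weilArchTerm (weilConv g (weilReflect g)) -
            ∑' n : ℕ, ((ArithmeticFunction.vonMangoldt n : ℝ) : ℂ) / (Real.sqrt n : ℂ) *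
              (weilConv g (weilReflect g) (Real.log n) + weilConv g (weilReflect g) (-Real.log n))).re| ≤
          ε * ∫ u, ‖g u‖ ^ 2 := by
  intro α L hα b₁ hb hsupp θ hθ0 hθ1 ε hε
  by_cases hdeg : (∃ ℓ, 1 ≤ ℓ ∧ ℓ ≤ L ∧ α ℓ ≠ 0) ∧ (∫ u, ‖b₁ u‖ ^ 2) ≠ 0
  · -- the non-degenerate case
    obtain ⟨hne, hB0⟩ := hdeg
    have hBpos : 0 < ∫ u, ‖b₁ u‖ ^ 2 :=
      lt_of_le_of_ne (integral_nonneg fun u ↦ by positivity) (Ne.symm hB0)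
    set B : ℝ := ∫ u, ‖b₁ u‖ ^ 2 with hB
    -- the order of decay used above height `M/κ`
    set n : ℕ := ⌈1 / θ⌉₊ + 3 with hndef
    have hn3 : 3 ≤ n := by rw [hndef]; omega
    have hnθ : 2 < θ * (2 * n - 1) := by
      have h1 : (1 : ℝ) / θ ≤ ⌈1 / θ⌉₊ := Nat.le_ceil _
      have h2 : (n : ℝ) = ⌈1 / θ⌉₊ + 3 := by rw [hndef]; push_cast; ring
      have h3 : 1 / θ * θ = 1 := div_mul_cancel₀ _ hθ0.ne'
      nlinarith
    -- constants
    obtain ⟨CZ, hCZ, hzero⟩ := exists_norm_weilZeroSidePartial_comb_le_complex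
    obtain ⟨cN, hcN, CN, hCN, hnorm⟩ := exists_integral_norm_sq_comb_ge_complex hα hne hb hsupp
    set Cα : ℝ := ∑ ℓ ∈ Finset.Icc 1 L, ‖α ℓ‖ * Real.sqrt ℓ with hCα
    set W₁ : ℝ := weilL1 b₁ with hW₁
    set Dn : ℝ := weilL1 (deriv^[n] b₁) with hDn
    set A₁ : ℝ := CZ * Cα ^ 2 * W₁ ^ 2 with hA₁
    set A₂ : ℝ := CZ * Cα ^ 2 * Dn ^ 2 with hA₂
    have hA₁0 : 0 ≤ A₁ := by positivity
    have hA₂0 : 0 ≤ A₂ := by positivity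
    have hE : 0 < ε * B * cN := by positivity
    obtain ⟨M₀, hM₀⟩ := Filter.eventually_atTop.1
      (eventually_budget_nat hθ0 hθ1 hnθ hA₁0 hA₂0 hE (ε * B * CN))
    refine ⟨M₀, fun M hM ↦ ?_⟩
    obtain ⟨hlog1, h8κ, hbudget⟩ := hM₀ M hM
    dsimp only
    simp only [mul_div_assoc]
    set κ : ℝ := Real.log M ^ θ with hκ
    have hκ1 : 1 ≤ κ := by
      rw [hκ]; exact Real.one_le_rpow hlog1 hθ0.le
    have hκ0 : 0 < κ := by linarith
    have hκM : κ ≤ M := by linarith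
    have hM0 : (0 : ℝ) < M := by linarith
    set g : ℝ → ℂ := fun u : ℝ ↦ ∑ m ∈ Finset.range (L * M + 1),
      (∑ k ∈ (Nat.divisors m).filter (· ≤ M), α (m / k) / (Real.sqrt k : ℂ)) *
        b₁ ((u - Real.log m) * ((M : ℝ) / κ)) with hg
    set K : ℝ → ℂ := weilConv g (weilReflect g) with hK
    -- `g` and `K` are Weil tests
    have hgt : IsWeilTest g := isWeilTest_logComb hb _ _ (div_pos hM0 hκ0).ne'
    have hKt : IsWeilTest K := hgt.weilConv hgt.weilReflect
    -- the zero side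
    have hZ : ∀ T : ℝ, ‖weilZeroSidePartial K T‖ ≤ CZ * Cα ^ 2 * (κ / M) ^ 2 *
        (W₁ ^ 2 * M + Dn ^ 2 / κ ^ (2 * n) * (1 + Real.log M) ^ 3 * M) :=
      fun T ↦ hzero α L hα b₁ hb n hn3 M κ hκ1 hκM T
    have hW := norm_weilFunctional_le_of_partial_le hKt hZ
    -- the norm
    have hN := hnorm M κ hκ1 h8κ
    -- the budget: `ZERO ≤ ε · NORM`
    have halg : CZ * Cα ^ 2 * (κ / M) ^ 2 *
          (W₁ ^ 2 * M + Dn ^ 2 / κ ^ (2 * n) * (1 + Real.log M) ^ 3 * M)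
        = κ / M * (A₁ * κ + A₂ * (κ / κ ^ (2 * n)) * (1 + Real.log M) ^ 3) := by
      rw [hA₁, hA₂]
      field_simp
    have hmain : CZ * Cα ^ 2 * (κ / M) ^ 2 *
          (W₁ ^ 2 * M + Dn ^ 2 / κ ^ (2 * n) * (1 + Real.log M) ^ 3 * M)
        ≤ ε * ∫ u, ‖g u‖ ^ 2 := by
      rw [halg]
      calc κ / M * (A₁ * κ + A₂ * (κ / κ ^ (2 * n)) * (1 + Real.log M) ^ 3)
          ≤ κ / M * (ε * B * cN * Real.log (M / κ) - ε * B * CN) :=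
            mul_le_mul_of_nonneg_left hbudget (by positivity)
        _ = ε * (κ / M * B * (cN * Real.log (M / κ) - CN)) := by ring
        _ ≤ ε * ∫ u, ‖g u‖ ^ 2 := mul_le_mul_of_nonneg_left hN hε.le
    -- conclusion
    have hfin : |(weilFunctional K).re| ≤ ε * ∫ u, ‖g u‖ ^ 2 :=
      (Complex.abs_re_le_norm _).trans (hW.trans hmain)
    show |(weilPolarTerm K + weilArchTerm K -
        ∑' n : ℕ, ((ArithmeticFunction.vonMangoldt n : ℝ) : ℂ) / (Real.sqrt n : ℂ) *
          (K (Real.log n) + K (-Real.log n))).re| ≤ ε * ∫ u, ‖g u‖ ^ 2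
    rw [polar_add_arch_sub_prime_eq K]
    exact hfin
  · -- the degenerate case: `g ≡ 0`
    refine ⟨1, fun M _ ↦ ?_⟩
    dsimp only
    simp only [mul_div_assoc]
    set κ : ℝ := Real.log M ^ θ with hκ
    have hcoef0 :
        (∀ m, (∑ k ∈ (Nat.divisors m).filter (· ≤ M), α (m / k) / (Real.sqrt k : ℂ)) = 0)
        ∨ b₁ = 0 := by
      rw [not_and_or] at hdeg
      rcases hdeg with h | h
      · left
        intro m
        refine Finset.sum_eq_zero fun k hk ↦ ?_
        obtain ⟨hkd, -⟩ := Finset.mem_filter.1 hk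
        obtain ⟨hkm, hm0⟩ := Nat.mem_divisors.1 hkd
        have hq1 : 1 ≤ m / k := by
          have hkpos : 0 < k := Nat.pos_of_dvd_of_pos hkm (Nat.pos_of_ne_zero hm0)
          exact Nat.div_pos (Nat.le_of_dvd (Nat.pos_of_ne_zero hm0) hkm) hkpos
        by_cases hqL : m / k ≤ L
        · have : α (m / k) = 0 := by
            by_contra hne'
            exact h ⟨m / k, hq1, hqL, hne'⟩
          rw [this, zero_div]
        · rw [hα _ (not_le.1 hqL), zero_div]
      · right
        push Not at h
        exact hb.eq_zero_of_integral_norm_sq_eq_zero h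
    have hterm : ∀ (m : ℕ) (y : ℝ),
        (∑ k ∈ (Nat.divisors m).filter (· ≤ M), α (m / k) / (Real.sqrt k : ℂ)) * b₁ y = 0 := by
      intro m y
      rcases hcoef0 with h | h
      · rw [h m]; simp
      · rw [h]; simp
    have hg0 : (fun u : ℝ ↦ ∑ m ∈ Finset.range (L * M + 1),
        (∑ k ∈ (Nat.divisors m).filter (· ≤ M), α (m / k) / (Real.sqrt k : ℂ)) *
          b₁ ((u - Real.log m) * ((M : ℝ) / κ))) = 0 := by
      funext u
      simp only [Pi.zero_apply]
      exact Finset.sum_eq_zero fun m _ ↦ hterm m _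
    rw [hg0]
    have hK0 : weilConv (0 : ℝ → ℂ) (weilReflect 0) = 0 := by
      unfold weilConv; exact zero_convolution
    rw [hK0]
    have hrhs : 0 ≤ ε * ∫ u, ‖∑ m ∈ Finset.range (L * M + 1),
        (∑ k ∈ (Nat.divisors m).filter (· ≤ M), α (m / k) / (Real.sqrt k : ℂ)) *
          b₁ ((u - Real.log m) * ((M : ℝ) / κ))‖ ^ 2 :=
      mul_nonneg hε.le (integral_nonneg fun u ↦ by positivity)
    have hlhs : weilPolarTerm (0 : ℝ → ℂ) + weilArchTerm 0 -
        ∑' n : ℕ, ((ArithmeticFunction.vonMangoldt n : ℝ) : ℂ) / (Real.sqrt n : ℂ) *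
          ((0 : ℝ → ℂ) (Real.log n) + (0 : ℝ → ℂ) (-Real.log n)) = 0 := by
      simp [weilPolarTerm, weilArchTerm, weilArchIntegral, weilMellin]
    rw [hlhs]
    simpa using hrhs

end Summit.RiemannHypothesis.RiemannHypothesis.Theorems.SignConeConeMagnification
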